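import Literature.Analysis.FluidPDE.HeatDivFormTopImprovementQuant
import Literature.Analysis.FluidPDE.NSVorticityBoundedTop
import HarnessLib

/-!
# Bounded vorticity and Hölder slices up to the top, with the constants fixed before the solution

Analysis/FluidPDE proofs file (theorems only; no definitions, no named facts). The accepted
`SerrinTop.spin_bounded_top` and `SerrinTop.holder_slices_top` (`NSVorticityBoundedTop.lean`;
Serrin 1962, Robinson–Rodrigo–Sadowski 2016, Thm. 13.7 with `q = q' = ∞`, proof §13.3.2) bound
the spin `∇u - ∇uᵀ` of an essentially bounded distributional Navier–Stokes solution with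
`∇u ∈ L²` on a centred cylinder, and make its slices Hölder continuous, up to the top time — with
constants produced *after* the solution (`∃ K`, `∃ C α`). Regularity statements that track the
dependence of the norms on the data (Seregin–Šverák 2009, arXiv:0804.1803, §2 p. 8: "the
corresponding norms are estimated by constants depending on `‖v‖_{3,Q}`, `‖q‖_{3/2,Q}`,
`‖v‖_{∞,Q₁}` …"; used along the blow-up sequence of §4 p. 11, vendored for `k = 0` as
`SereginSverak2009.LocalHolderBound`) need the constants fixed *before* the solution, in terms
of the velocity bound `M`, a bound `B` for `∫∫ |∇u|²` and the radii. This file proves exactly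
that, on cylinders normalised to top time `0` and centre `0`
(`Q*_R((-R², 0)) = ]-2R², 0[ × B(0, R)`):

* `SerrinTopQuant.spin_bound_top_quant` — `∀ r < R, M, B ∃ K ∀ (u, p, G) …`: the spin entries are
  essentially bounded by `K` on `]-R² - r², 0[ × B(0, r)`;
* `SerrinTopQuant.holder_slices_top_quant` — `∀ r < R, M, B ∃ C, α > 0 ∀ (u, p, G) …`: for a.e.
  `t ∈ ]-R² - r², 0[` the slice `u(t, ·)` agrees a.e. on `B(0, r)` with a `(C, α)`-Hölder field.

## Proofs

Those of the accepted theorems, verbatim, with the three improvement rounds `2 → 3 → 6 → ∞` run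
through the accepted quantitative improvement `HeatDivForm.heatDivForm_improvement_top_quant`
(`HeatDivFormTopImprovementQuant.lean`), tracking `S_m(Q) = Σᵢⱼ ‖A_{ij}‖_{L^m(Q)}`: the flux of
the weak spin equation (`NSSpinHeatEquation_holds`) satisfies `‖spinFlux‖ ≤ 2|M| Σᵢⱼ |A_{ij}|`
pointwise (`norm_spinFlux_le`), hence `S_{m'}(Q') ≤ 9 C (1 + 2|M|) S_m(Q)` per round, and
`S_2 ≤ 18 (∫∫|∇u|²)^{1/2}` at the start. The slice constants of
`SerrinBoundedHolder.exists_holder_slice` (with the discharged `LaplaceDivFormInteriorHolder_holds`)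
already depend on the radii only.

## References

* J. C. Robinson, J. L. Rodrigo, W. Sadowski, *The Three-Dimensional Navier–Stokes Equations.
  Classical theory*, CUP 2016, Thm. 13.7, proof §13.3.2 Steps 1–4, (13.11)–(13.19).
  [`RobinsonRodrigoSadowskiCUP2016`]
* J. Serrin, Arch. Rational Mech. Anal. 9 (1962) 187–195. [`Serrin1962`]
* G. Seregin, V. Šverák, Comm. PDE 34 (2009) = arXiv:0804.1803, §2 p. 8, §4 p. 11.
  [`SereginSverak2009`]
-/

noncomputable section

open MeasureTheory Set Function Filter Topology TopologicalSpace Metric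
open scoped NNReal ENNReal RealInnerProductSpace Laplacian

namespace Literature.Analysis.FluidPDE

namespace SerrinTopQuant

/-- Pointwise bound of the spin flux by the velocity bound and the sum of all spin entries:
`‖spinFlux u G b c (q)‖ ≤ 2 |M| Σᵢⱼ |A_{ij}(q)|` wherever `‖u(q)‖ ≤ M`. [folklore] -/
theorem norm_spinFlux_le {u : ℝ → (EuclideanSpace ℝ (Fin 3)) → (EuclideanSpace ℝ (Fin 3))} {G : ℝ → (EuclideanSpace ℝ (Fin 3)) → (EuclideanSpace ℝ (Fin 3)) →L[ℝ] (EuclideanSpace ℝ (Fin 3))} {M : ℝ} {q : ℝ × (EuclideanSpace ℝ (Fin 3))}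
    (hq : ‖u q.1 q.2‖ ≤ M) (b c : Fin 3) :
    ‖spinFlux u G b c q‖ ≤ 2 * |M| * ∑ i, ∑ j, |spinEntry G i j q| := by
  have habs : ∀ j : Fin 3, |u q.1 q.2 j| ≤ |M| := fun j => by
    have h1 : |u q.1 q.2 j| ≤ ‖u q.1 q.2‖ := by
      simpa [Real.norm_eq_abs] using PiLp.norm_apply_le (u q.1 q.2) j
    exact (h1.trans hq).trans (le_abs_self M)
  have hrow : ∀ i : Fin 3, |∑ j, u q.1 q.2 j * spinEntry G i j q| ≤
      |M| * ∑ i', ∑ j, |spinEntry G i' j q| := by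
    intro i
    calc |∑ j, u q.1 q.2 j * spinEntry G i j q| ≤ ∑ j, |u q.1 q.2 j * spinEntry G i j q| :=
          Finset.abs_sum_le_sum_abs _ _
      _ ≤ ∑ j, |M| * |spinEntry G i j q| := Finset.sum_le_sum fun j _ => by
          rw [abs_mul]
          exact mul_le_mul_of_nonneg_right (habs j) (abs_nonneg _)
      _ = |M| * ∑ j, |spinEntry G i j q| := by rw [Finset.mul_sum]
      _ ≤ |M| * ∑ i', ∑ j, |spinEntry G i' j q| := by
          refine mul_le_mul_of_nonneg_left ?_ (abs_nonneg M)
          exact Finset.single_le_sum (f := fun i' => ∑ j, |spinEntry G i' j q|)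
            (fun i' _ => Finset.sum_nonneg fun j _ => abs_nonneg _) (Finset.mem_univ i)
  have he : ∀ j : Fin 3, ‖(EuclideanSpace.single (j : Fin 3) (1 : ℝ) : (EuclideanSpace ℝ (Fin 3)))‖ = 1 := fun j => by simp
  rw [spinFlux]
  calc ‖(-(∑ j, u q.1 q.2 j * spinEntry G b j q)) • (EuclideanSpace.single (c : Fin 3) (1 : ℝ)) + (∑ j, u q.1 q.2 j * spinEntry G c j q) • (EuclideanSpace.single (b : Fin 3) (1 : ℝ))‖
      ≤ ‖(-(∑ j, u q.1 q.2 j * spinEntry G b j q)) • (EuclideanSpace.single (c : Fin 3) (1 : ℝ))‖ + ‖(∑ j, u q.1 q.2 j * spinEntry G c j q) • (EuclideanSpace.single (b : Fin 3) (1 : ℝ))‖ :=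
        norm_add_le _ _
    _ = |∑ j, u q.1 q.2 j * spinEntry G b j q| + |∑ j, u q.1 q.2 j * spinEntry G c j q| := by
        rw [norm_smul, norm_smul, he, he, mul_one, mul_one, norm_neg, Real.norm_eq_abs, Real.norm_eq_abs]
    _ ≤ |M| * ∑ i', ∑ j, |spinEntry G i' j q| + |M| * ∑ i', ∑ j, |spinEntry G i' j q| :=
        add_le_add (hrow b) (hrow c)
    _ = 2 * |M| * ∑ i, ∑ j, |spinEntry G i j q| := by ring

/-- **`L^m` bound of the spin flux**: `‖spinFlux‖_{L^m} ≤ 2|M| Σᵢⱼ ‖A_{ij}‖_{L^m}` for `m ≥ 1`,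
`|u| ≤ M` a.e. [folklore] -/
theorem eLpNorm_spinFlux_le {μ : Measure (ℝ × (EuclideanSpace ℝ (Fin 3)))} {m : ℝ≥0∞} (hm : 1 ≤ m) {u : ℝ → (EuclideanSpace ℝ (Fin 3)) → (EuclideanSpace ℝ (Fin 3))}
    {G : ℝ → (EuclideanSpace ℝ (Fin 3)) → (EuclideanSpace ℝ (Fin 3)) →L[ℝ] (EuclideanSpace ℝ (Fin 3))} {M : ℝ} (hM : ∀ᵐ q ∂μ, ‖u q.1 q.2‖ ≤ M)
    (hGm : AEStronglyMeasurable (uncurry G) μ) (b c : Fin 3) :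
    eLpNorm (spinFlux u G b c) m μ ≤
      ENNReal.ofReal (2 * |M|) * ∑ i, ∑ j, eLpNorm (spinEntry G i j) m μ := by
  set F : ℝ × (EuclideanSpace ℝ (Fin 3)) → ℝ := fun q => ∑ i, ∑ j, |spinEntry G i j q| with hF
  have h1 : eLpNorm (spinFlux u G b c) m μ ≤ ENNReal.ofReal (2 * |M|) * eLpNorm F m μ := by
    refine eLpNorm_le_mul_eLpNorm_of_ae_le_mul ?_ m
    filter_upwards [hM] with q hq
    have hF0 : 0 ≤ F q := Finset.sum_nonneg fun i _ => Finset.sum_nonneg fun j _ => abs_nonneg _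
    rw [Real.norm_eq_abs, abs_of_nonneg hF0]
    exact norm_spinFlux_le hq b c
  have h2 : eLpNorm F m μ ≤ ∑ i, ∑ j, eLpNorm (spinEntry G i j) m μ := by
    have hmeas : ∀ i j : Fin 3, AEStronglyMeasurable (fun q => |spinEntry G i j q|) μ := fun i j =>
      (continuous_abs.comp_aestronglyMeasurable (aestronglyMeasurable_spinEntry hGm i j))
    have eF : F = ∑ i, ∑ j, fun q => |spinEntry G i j q| := by
      funext q
      simp only [hF, Finset.sum_apply]
    rw [eF]
    calc eLpNorm (∑ i, ∑ j, fun q => |spinEntry G i j q|) m μ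
        ≤ ∑ i, eLpNorm (∑ j, fun q => |spinEntry G i j q|) m μ :=
          eLpNorm_sum_le (fun i _ => Finset.aestronglyMeasurable_sum _ fun j _ => hmeas i j) hm
      _ ≤ ∑ i, ∑ j, eLpNorm (fun q => |spinEntry G i j q|) m μ :=
          Finset.sum_le_sum fun i _ => eLpNorm_sum_le (fun j _ => hmeas i j) hm
      _ = ∑ i, ∑ j, eLpNorm (spinEntry G i j) m μ := by
          refine Finset.sum_congr rfl fun i _ => Finset.sum_congr rfl fun j _ => ?_
          have : (fun q => |spinEntry G i j q|) = fun q => ‖spinEntry G i j q‖ := by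
            funext q; rw [Real.norm_eq_abs]
          rw [this, eLpNorm_norm]
  calc eLpNorm (spinFlux u G b c) m μ ≤ ENNReal.ofReal (2 * |M|) * eLpNorm F m μ := h1
    _ ≤ ENNReal.ofReal (2 * |M|) * ∑ i, ∑ j, eLpNorm (spinEntry G i j) m μ := by gcongr

/-- Each spin entry is bounded in `L^m` by the sum of all of them. [folklore] -/
theorem eLpNorm_spinEntry_le_sum {μ : Measure (ℝ × (EuclideanSpace ℝ (Fin 3)))} {m : ℝ≥0∞} (G : ℝ → (EuclideanSpace ℝ (Fin 3)) → (EuclideanSpace ℝ (Fin 3)) →L[ℝ] (EuclideanSpace ℝ (Fin 3)))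
    (b c : Fin 3) : eLpNorm (spinEntry G b c) m μ ≤ ∑ i, ∑ j, eLpNorm (spinEntry G i j) m μ :=
  calc eLpNorm (spinEntry G b c) m μ ≤ ∑ j, eLpNorm (spinEntry G b j) m μ :=
        Finset.single_le_sum (f := fun j => eLpNorm (spinEntry G b j) m μ) (fun _ _ => zero_le)
          (Finset.mem_univ c)
    _ ≤ ∑ i, ∑ j, eLpNorm (spinEntry G i j) m μ :=
        Finset.single_le_sum (f := fun i => ∑ j, eLpNorm (spinEntry G i j) m μ) (fun _ _ => zero_le)
          (Finset.mem_univ b)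

/-- The spin entries are in `L²` with `Σᵢⱼ ‖A_{ij}‖_{L²} ≤ 18 (∫∫ |G|²)^{1/2}` (`|A_{ij}| ≤ 2‖G‖`,
`‖G‖² ≤ |G|²_F`). [folklore] -/
theorem sum_eLpNorm_spinEntry_two_le (s : Set (ℝ × (EuclideanSpace ℝ (Fin 3)))) (G : ℝ → (EuclideanSpace ℝ (Fin 3)) → (EuclideanSpace ℝ (Fin 3)) →L[ℝ] (EuclideanSpace ℝ (Fin 3))) :
    ∑ i, ∑ j, eLpNorm (spinEntry G i j) 2 (volume.restrict s) ≤
      18 * (∫⁻ w in s, ENNReal.ofReal (frobeniusNormSq (G w.1 w.2))) ^ (1 / 2 : ℝ) := by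
  have hG2 : eLpNorm (uncurry G) 2 (volume.restrict s) ≤
      (∫⁻ w in s, ENNReal.ofReal (frobeniusNormSq (G w.1 w.2))) ^ (1 / 2 : ℝ) := by
    rw [eLpNorm_eq_lintegral_rpow_enorm_toReal two_ne_zero ENNReal.ofNat_ne_top, ENNReal.toReal_ofNat]
    refine ENNReal.rpow_le_rpow ?_ (by norm_num)
    exact lintegral_mono fun w => SerrinBoundedHolder.enorm_rpow_two_le_ofReal_frobeniusNormSq _
  have hent : ∀ i j : Fin 3, eLpNorm (spinEntry G i j) 2 (volume.restrict s) ≤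
      2 * (∫⁻ w in s, ENNReal.ofReal (frobeniusNormSq (G w.1 w.2))) ^ (1 / 2 : ℝ) := by
    intro i j
    have h1 : eLpNorm (spinEntry G i j) 2 (volume.restrict s) ≤
        ENNReal.ofReal 2 * eLpNorm (uncurry G) 2 (volume.restrict s) := by
      refine eLpNorm_le_mul_eLpNorm_of_ae_le_mul (Eventually.of_forall fun q => ?_) 2
      rw [Real.norm_eq_abs]
      exact abs_spinEntry_le G i j q
    rw [ENNReal.ofReal_ofNat] at h1
    exact h1.trans (by gcongr)
  calc ∑ i, ∑ j, eLpNorm (spinEntry G i j) 2 (volume.restrict s)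
      ≤ ∑ _i : Fin 3, ∑ _j : Fin 3, 2 * (∫⁻ w in s, ENNReal.ofReal (frobeniusNormSq (G w.1 w.2))) ^ (1 / 2 : ℝ) :=
        Finset.sum_le_sum fun i _ => Finset.sum_le_sum fun j _ => hent i j
    _ = 18 * (∫⁻ w in s, ENNReal.ofReal (frobeniusNormSq (G w.1 w.2))) ^ (1 / 2 : ℝ) := by
        simp only [Finset.sum_const, Finset.card_univ, Fintype.card_fin, nsmul_eq_mul]
        push_cast
        ring

/-- **Bounded vorticity up to the top, with the bound fixed before the solution**
(Robinson–Rodrigo–Sadowski 2016, Thm. 13.7, proof §13.3.2 Steps 1–2 for `q = q' = ∞`, made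
quantitative; the form consumed by Seregin–Šverák 2009, §2 p. 8 / §4 p. 11, "the corresponding
norms are estimated by constants depending on the data"). For `0 < r < R`, a velocity bound `M`
and a gradient bound `B` there is `K` such that: whenever `(u, p)` solves the Navier–Stokes system
(`ν = 1`, no force) in the sense of distributions in the centred cylinder
`Q*_R((-R², 0)) = ]-2R², 0[ × B(0, R)` (top time `0`), with `|u| ≤ M` a.e., a weak spatial
gradient `G` and `∫∫ |G|² ≤ B`, the spin entries `Gᵢⱼ - Gⱼᵢ` are essentially bounded by `K` on
`]-R² - r², 0[ × B(0, r)` — up to the top. Proof: the accepted `SerrinTop.spin_bounded_top` with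
the three improvement rounds `2 → 3 → 6 → ∞` run through
`HeatDivForm.heatDivForm_improvement_top_quant` (constants chosen before the solution), the flux
bound `‖spinFlux‖_{L^m} ≤ 2|M| Σ ‖A_{ij}‖_{L^m}` and the start `Σ ‖A_{ij}‖_{L²} ≤ 18 B^{1/2}`.
[cite: RobinsonRodrigoSadowskiCUP2016, Thm. 13.7, proof §13.3.2 Steps 1–2 with (13.17) (q = q' = ∞); SereginSverak2009 §2 p. 8] -/
theorem spin_bound_top_quant {R r : ℝ} (hr0 : 0 < r) (hrR : r < R) (M : ℝ) (B : ℝ≥0) :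
    ∃ K : ℝ, 0 ≤ K ∧ ∀ (u : ℝ → (EuclideanSpace ℝ (Fin 3)) → (EuclideanSpace ℝ (Fin 3))) (p : ℝ → (EuclideanSpace ℝ (Fin 3)) → ℝ) (G : ℝ → (EuclideanSpace ℝ (Fin 3)) → (EuclideanSpace ℝ (Fin 3)) →L[ℝ] (EuclideanSpace ℝ (Fin 3))),
      IsDistributionalNSSolutionOn (parabolicCylinderCenteredOpens R ((-R ^ 2 : ℝ), (0 : (EuclideanSpace ℝ (Fin 3))))) 1 0 u p →
      (∀ᵐ w ∂(volume.restrict (parabolicCylinderCentered R ((-R ^ 2 : ℝ), (0 : (EuclideanSpace ℝ (Fin 3)))))),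
        ‖u w.1 w.2‖ ≤ M) →
      HasWeakSpatialGradientOn (parabolicCylinderCenteredOpens R ((-R ^ 2 : ℝ), (0 : (EuclideanSpace ℝ (Fin 3))))) u G →
      (∫⁻ w in parabolicCylinderCentered R ((-R ^ 2 : ℝ), (0 : (EuclideanSpace ℝ (Fin 3)))),
          ENNReal.ofReal (frobeniusNormSq (G w.1 w.2)) ≤ B) →
      ∀ᵐ w ∂(volume.restrict (Ioo (-R ^ 2 - r ^ 2) 0 ×ˢ ball (0 : (EuclideanSpace ℝ (Fin 3))) r)), ∀ i j : Fin 3,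
        |G w.1 w.2 (EuclideanSpace.single (j : Fin 3) (1 : ℝ)) i - G w.1 w.2 (EuclideanSpace.single (i : Fin 3) (1 : ℝ)) j| ≤ K := by
  have hR0 : 0 < R := hr0.trans hrR
  have hsq : r ^ 2 < R ^ 2 := by nlinarith
  -- radii `r < ρ₂ < ρ₁ < R` and depths `R² + r² < L₂ < L₁ < 2R²`
  set ρ₁ : ℝ := r + 2 * (R - r) / 3 with hρ₁
  set ρ₂ : ℝ := r + (R - r) / 3 with hρ₂
  have hrρ₂ : r < ρ₂ := by rw [hρ₂]; linarith
  have hρ₂ρ₁ : ρ₂ < ρ₁ := by rw [hρ₁, hρ₂]; linarith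
  have hρ₁R : ρ₁ < R := by rw [hρ₁]; linarith
  have hρ₂0 : 0 < ρ₂ := hr0.trans hrρ₂
  have hρ₁0 : 0 < ρ₁ := hρ₂0.trans hρ₂ρ₁
  set L₁ : ℝ := 2 * R ^ 2 - (2 * R ^ 2 - (R ^ 2 + r ^ 2)) / 3 with hL₁
  set L₂ : ℝ := 2 * R ^ 2 - 2 * (2 * R ^ 2 - (R ^ 2 + r ^ 2)) / 3 with hL₂
  have hL30 : 0 < R ^ 2 + r ^ 2 := by positivity
  have hL32 : R ^ 2 + r ^ 2 < L₂ := by rw [hL₂]; nlinarith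
  have hL21 : L₂ < L₁ := by rw [hL₁, hL₂]; nlinarith
  have hL10 : L₁ < 2 * R ^ 2 := by rw [hL₁]; nlinarith
  have hL20 : 0 < L₂ := hL30.trans hL32
  have hL1pos : 0 < L₁ := hL20.trans hL21
  -- the three constants, fixed before the solution
  obtain ⟨e23, e36, e6t⟩ := improvement_exponents
  obtain ⟨C₁, hC₁⟩ := HeatDivForm.heatDivForm_improvement_top_quant (m := 2) (r := 3) (by norm_num)
    (by norm_num) e23 (L := 2 * R ^ 2) (L' := L₁) (ρ := R) (ρ' := ρ₁) hL1pos hL10 hρ₁0 hρ₁R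
  obtain ⟨C₂, hC₂⟩ := HeatDivForm.heatDivForm_improvement_top_quant (m := 3) (r := 6) (by norm_num)
    (by norm_num) e36 (L := L₁) (L' := L₂) (ρ := ρ₁) (ρ' := ρ₂) hL20 hL21 hρ₂0 hρ₂ρ₁
  obtain ⟨C₃, hC₃⟩ := HeatDivForm.heatDivForm_improvement_top_quant (m := 6) (r := ⊤) (by norm_num)
    le_top e6t (L := L₂) (L' := R ^ 2 + r ^ 2) (ρ := ρ₂) (ρ' := r) hL30 hL32 hr0 hrρ₂
  set Aenn : ℝ≥0∞ := 1 + ENNReal.ofReal (2 * |M|) with hAenn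
  have hAtop : Aenn ≠ ⊤ := by
    rw [hAenn]; exact ENNReal.add_ne_top.2 ⟨ENNReal.one_ne_top, ENNReal.ofReal_ne_top⟩
  set Kenn : ℝ≥0∞ := 9 * (C₃ : ℝ≥0∞) * Aenn * (9 * (C₂ : ℝ≥0∞) * Aenn *
    (9 * (C₁ : ℝ≥0∞) * Aenn * (18 * (B : ℝ≥0∞) ^ (1 / 2 : ℝ)))) with hKenn
  have hKtop : Kenn ≠ ⊤ := by
    rw [hKenn]
    have hB : (B : ℝ≥0∞) ^ (1 / 2 : ℝ) ≠ ⊤ :=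
      ENNReal.rpow_ne_top_of_nonneg (by norm_num) ENNReal.coe_ne_top
    have h18 : (18 : ℝ≥0∞) * (B : ℝ≥0∞) ^ (1 / 2 : ℝ) ≠ ⊤ := ENNReal.mul_ne_top (by norm_num) hB
    have h9 : ∀ C : ℝ≥0, 9 * (C : ℝ≥0∞) * Aenn ≠ ⊤ := fun C =>
      ENNReal.mul_ne_top (ENNReal.mul_ne_top (by norm_num) ENNReal.coe_ne_top) hAtop
    exact ENNReal.mul_ne_top (h9 C₃) (ENNReal.mul_ne_top (h9 C₂) (ENNReal.mul_ne_top (h9 C₁) h18))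
  refine ⟨Kenn.toReal, ENNReal.toReal_nonneg, ?_⟩
  intro u p G hsol hbd hG hGB
  set z₀ : ℝ × (EuclideanSpace ℝ (Fin 3)) := ((-R ^ 2 : ℝ), (0 : (EuclideanSpace ℝ (Fin 3)))) with hz₀
  have hG2 : ∫⁻ w in parabolicCylinderCentered R z₀, ENNReal.ofReal (frobeniusNormSq (G w.1 w.2)) < ∞ :=
    lt_of_le_of_lt hGB ENNReal.coe_lt_top
  -- the product cylinders sharing the top `0`
  have hsubC : ∀ {L ρ : ℝ}, L ≤ 2 * R ^ 2 → ρ ≤ R →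
      Ioo (-L) 0 ×ˢ ball (0 : (EuclideanSpace ℝ (Fin 3))) ρ ⊆ parabolicCylinderCentered R z₀ := by
    intro L ρ hL hρ
    refine prod_mono (Ioo_subset_Ioo ?_ ?_) (ball_subset_ball hρ)
    · show -R ^ 2 - R ^ 2 ≤ -L
      linarith
    · show (0 : ℝ) ≤ -R ^ 2 + R ^ 2
      linarith
  have hQ₀ : Ioo (-(2 * R ^ 2)) 0 ×ˢ ball (0 : (EuclideanSpace ℝ (Fin 3))) R = parabolicCylinderCentered R z₀ := by
    show Ioo (-(2 * R ^ 2)) 0 ×ˢ ball (0 : (EuclideanSpace ℝ (Fin 3))) R =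
      Ioo (-R ^ 2 - R ^ 2) (-R ^ 2 + R ^ 2) ×ˢ ball (0 : (EuclideanSpace ℝ (Fin 3))) R
    rw [show -R ^ 2 - R ^ 2 = -(2 * R ^ 2) by ring, show -R ^ 2 + R ^ 2 = (0 : ℝ) by ring]
  -- the weak equation for tests on any of them
  have heq : ∀ (L ρ : ℝ), L ≤ 2 * R ^ 2 → ρ ≤ R → ∀ (b c : Fin 3) (ψ : ℝ → (EuclideanSpace ℝ (Fin 3)) → ℝ),
      IsSpaceTimeTestOn (⟨Ioo (-L) 0 ×ˢ ball (0 : (EuclideanSpace ℝ (Fin 3))) ρ, isOpen_Ioo.prod isOpen_ball⟩ :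
        Opens (ℝ × (EuclideanSpace ℝ (Fin 3)))) ψ →
      ∫ q : ℝ × (EuclideanSpace ℝ (Fin 3)), spinEntry G b c q * (timeDeriv ψ q.1 q.2 + (Δ (ψ q.1)) q.2) =
        ∫ q : ℝ × (EuclideanSpace ℝ (Fin 3)), ⟪spinFlux u G b c q, gradient (ψ q.1) q.2⟫ := by
    intro L ρ hL hρ b c ψ hψ
    have hle : (⟨Ioo (-L) 0 ×ˢ ball (0 : (EuclideanSpace ℝ (Fin 3))) ρ, isOpen_Ioo.prod isOpen_ball⟩ :
        Opens (ℝ × (EuclideanSpace ℝ (Fin 3)))) ≤ parabolicCylinderCenteredOpens R z₀ :=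
      fun q hq => hsubC hL hρ hq
    exact NSSpinHeatEquation_holds u p z₀ R M G hsol hbd hG hG2 b c ψ (hψ.mono hle)
  -- measurability and boundedness of `u`, measurability of `G`, on the product cylinders
  have hdata : ∀ (L ρ : ℝ), L ≤ 2 * R ^ 2 → ρ ≤ R →
      AEStronglyMeasurable (uncurry u) (volume.restrict (Ioo (-L) 0 ×ˢ ball (0 : (EuclideanSpace ℝ (Fin 3))) ρ)) ∧
      (∀ᵐ q ∂(volume.restrict (Ioo (-L) 0 ×ˢ ball (0 : (EuclideanSpace ℝ (Fin 3))) ρ)), ‖u q.1 q.2‖ ≤ M) ∧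
      AEStronglyMeasurable (uncurry G) (volume.restrict (Ioo (-L) 0 ×ˢ ball (0 : (EuclideanSpace ℝ (Fin 3))) ρ)) := by
    intro L ρ hL hρ
    have hsub := hsubC hL hρ
    exact ⟨(hsol.1.mono_set hsub).aestronglyMeasurable,
      ae_restrict_of_ae_restrict_of_subset hsub hbd,
      (hG.locallyIntegrableOn_grad.mono_set hsub).aestronglyMeasurable⟩
  -- one round of the improvement up to the top, for all entries at once, with the norms
  have round : ∀ (m m' : ℝ≥0∞) (L L' ρ ρ' : ℝ) (C : ℝ≥0), 1 ≤ m → L ≤ 2 * R ^ 2 → ρ ≤ R →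
      (∀ (w : ℝ × (EuclideanSpace ℝ (Fin 3)) → ℝ) (g : ℝ × (EuclideanSpace ℝ (Fin 3)) → (EuclideanSpace ℝ (Fin 3))),
        MemLp w m (volume.restrict (Ioo (-L) 0 ×ˢ ball (0 : (EuclideanSpace ℝ (Fin 3))) ρ)) →
        MemLp g m (volume.restrict (Ioo (-L) 0 ×ˢ ball (0 : (EuclideanSpace ℝ (Fin 3))) ρ)) →
        (∀ ψ : ℝ → (EuclideanSpace ℝ (Fin 3)) → ℝ,
          IsSpaceTimeTestOn (⟨Ioo (-L) 0 ×ˢ ball (0 : (EuclideanSpace ℝ (Fin 3))) ρ, isOpen_Ioo.prod isOpen_ball⟩ :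
            Opens (ℝ × (EuclideanSpace ℝ (Fin 3)))) ψ →
          ∫ q : ℝ × (EuclideanSpace ℝ (Fin 3)), w q * (timeDeriv ψ q.1 q.2 + (Δ (ψ q.1)) q.2) =
            ∫ q : ℝ × (EuclideanSpace ℝ (Fin 3)), ⟪g q, gradient (ψ q.1) q.2⟫) →
        MemLp w m' (volume.restrict (Ioo (-L') 0 ×ˢ ball (0 : (EuclideanSpace ℝ (Fin 3))) ρ')) ∧
        eLpNorm w m' (volume.restrict (Ioo (-L') 0 ×ˢ ball (0 : (EuclideanSpace ℝ (Fin 3))) ρ')) ≤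
          C * (eLpNorm w m (volume.restrict (Ioo (-L) 0 ×ˢ ball (0 : (EuclideanSpace ℝ (Fin 3))) ρ)) +
            eLpNorm g m (volume.restrict (Ioo (-L) 0 ×ˢ ball (0 : (EuclideanSpace ℝ (Fin 3))) ρ)))) →
      (∀ b c : Fin 3, MemLp (spinEntry G b c) m (volume.restrict (Ioo (-L) 0 ×ˢ ball (0 : (EuclideanSpace ℝ (Fin 3))) ρ))) →
      (∀ b c : Fin 3, MemLp (spinEntry G b c) m'
        (volume.restrict (Ioo (-L') 0 ×ˢ ball (0 : (EuclideanSpace ℝ (Fin 3))) ρ'))) ∧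
      ∑ b, ∑ c, eLpNorm (spinEntry G b c) m' (volume.restrict (Ioo (-L') 0 ×ˢ ball (0 : (EuclideanSpace ℝ (Fin 3))) ρ')) ≤
        9 * (C : ℝ≥0∞) * Aenn *
          ∑ b, ∑ c, eLpNorm (spinEntry G b c) m (volume.restrict (Ioo (-L) 0 ×ˢ ball (0 : (EuclideanSpace ℝ (Fin 3))) ρ)) := by
    intro m m' L L' ρ ρ' C hm1 hL hρ hC hs
    obtain ⟨hum, huM, hGm⟩ := hdata L ρ hL hρ
    set μ : Measure (ℝ × (EuclideanSpace ℝ (Fin 3))) := volume.restrict (Ioo (-L) 0 ×ˢ ball (0 : (EuclideanSpace ℝ (Fin 3))) ρ) with hμ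
    set μ' : Measure (ℝ × (EuclideanSpace ℝ (Fin 3))) := volume.restrict (Ioo (-L') 0 ×ˢ ball (0 : (EuclideanSpace ℝ (Fin 3))) ρ') with hμ'
    set S : ℝ≥0∞ := ∑ b, ∑ c, eLpNorm (spinEntry G b c) m μ with hS
    have hflux : ∀ b c : Fin 3, MemLp (spinFlux u G b c) m μ := memLp_spinFlux hum huM hs
    have hone : ∀ b c : Fin 3, MemLp (spinEntry G b c) m' μ' ∧
        eLpNorm (spinEntry G b c) m' μ' ≤
          C * (eLpNorm (spinEntry G b c) m μ + eLpNorm (spinFlux u G b c) m μ) :=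
      fun b c => hC _ _ (hs b c) (hflux b c) (heq L ρ hL hρ b c)
    refine ⟨fun b c => (hone b c).1, ?_⟩
    have hbound : ∀ b c : Fin 3, eLpNorm (spinEntry G b c) m' μ' ≤ (C : ℝ≥0∞) * Aenn * S := by
      intro b c
      calc eLpNorm (spinEntry G b c) m' μ'
          ≤ C * (eLpNorm (spinEntry G b c) m μ + eLpNorm (spinFlux u G b c) m μ) := (hone b c).2
        _ ≤ C * (S + ENNReal.ofReal (2 * |M|) * S) := by
            gcongr
            · exact eLpNorm_spinEntry_le_sum G b c
            · exact eLpNorm_spinFlux_le hm1 huM hGm b c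
        _ = (C : ℝ≥0∞) * Aenn * S := by rw [hAenn]; ring
    calc ∑ b, ∑ c, eLpNorm (spinEntry G b c) m' μ'
        ≤ ∑ _b : Fin 3, ∑ _c : Fin 3, (C : ℝ≥0∞) * Aenn * S :=
          Finset.sum_le_sum fun b _ => Finset.sum_le_sum fun c _ => hbound b c
      _ = 9 * (C : ℝ≥0∞) * Aenn * S := by
          simp only [Finset.sum_const, Finset.card_univ, Fintype.card_fin, nsmul_eq_mul]
          push_cast
          ring
  -- start: `A ∈ L²(Q*_R)` with `Σ ‖A_{ij}‖_{L²} ≤ 18 B^{1/2}`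
  have hstart : ∀ b c : Fin 3, MemLp (spinEntry G b c) 2
      (volume.restrict (Ioo (-(2 * R ^ 2)) 0 ×ˢ ball (0 : (EuclideanSpace ℝ (Fin 3))) R)) := by
    intro b c
    rw [hQ₀]
    have hGm : AEStronglyMeasurable (uncurry G) (volume.restrict (parabolicCylinderCentered R z₀)) :=
      hG.locallyIntegrableOn_grad.aestronglyMeasurable
    have hG2' := memLp_two_uncurry_of_lintegral_frobeniusNormSq hGm hG2
    refine hG2'.of_le_mul (aestronglyMeasurable_spinEntry hGm b c) (c := 2)
      (Eventually.of_forall fun q => ?_)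
    rw [Real.norm_eq_abs]
    exact abs_spinEntry_le G b c q
  have hstartS : ∑ b, ∑ c, eLpNorm (spinEntry G b c) 2
      (volume.restrict (Ioo (-(2 * R ^ 2)) 0 ×ˢ ball (0 : (EuclideanSpace ℝ (Fin 3))) R)) ≤ 18 * (B : ℝ≥0∞) ^ (1 / 2 : ℝ) := by
    rw [hQ₀]
    refine (sum_eLpNorm_spinEntry_two_le _ G).trans ?_
    gcongr
  -- three rounds
  obtain ⟨h3m, h3S⟩ := round 2 3 (2 * R ^ 2) L₁ R ρ₁ C₁ (by norm_num) le_rfl le_rfl hC₁ hstart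
  obtain ⟨h6m, h6S⟩ := round 3 6 L₁ L₂ ρ₁ ρ₂ C₂ (by norm_num) hL10.le hρ₁R.le hC₂ h3m
  obtain ⟨-, htS⟩ := round 6 ⊤ L₂ (R ^ 2 + r ^ 2) ρ₂ r C₃ (by norm_num) (hL21.trans hL10).le
    (hρ₂ρ₁.trans hρ₁R).le hC₃ h6m
  -- the essential suprema bound all entries
  set μ₃ : Measure (ℝ × (EuclideanSpace ℝ (Fin 3))) := volume.restrict (Ioo (-(R ^ 2 + r ^ 2)) 0 ×ˢ ball (0 : (EuclideanSpace ℝ (Fin 3))) r) with hμ₃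
  have hchain : ∑ b, ∑ c, eLpNorm (spinEntry G b c) ⊤ μ₃ ≤ Kenn := by
    calc ∑ b, ∑ c, eLpNorm (spinEntry G b c) ⊤ μ₃
        ≤ 9 * (C₃ : ℝ≥0∞) * Aenn *
            ∑ b, ∑ c, eLpNorm (spinEntry G b c) 6
              (volume.restrict (Ioo (-L₂) 0 ×ˢ ball (0 : (EuclideanSpace ℝ (Fin 3))) ρ₂)) := htS
      _ ≤ 9 * (C₃ : ℝ≥0∞) * Aenn * (9 * (C₂ : ℝ≥0∞) * Aenn *
            ∑ b, ∑ c, eLpNorm (spinEntry G b c) 3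
              (volume.restrict (Ioo (-L₁) 0 ×ˢ ball (0 : (EuclideanSpace ℝ (Fin 3))) ρ₁))) := by gcongr
      _ ≤ 9 * (C₃ : ℝ≥0∞) * Aenn * (9 * (C₂ : ℝ≥0∞) * Aenn * (9 * (C₁ : ℝ≥0∞) * Aenn *
            ∑ b, ∑ c, eLpNorm (spinEntry G b c) 2
              (volume.restrict (Ioo (-(2 * R ^ 2)) 0 ×ˢ ball (0 : (EuclideanSpace ℝ (Fin 3))) R)))) := by gcongr
      _ ≤ Kenn := by rw [hKenn]; gcongr
  have hwin : Ioo (-R ^ 2 - r ^ 2) 0 ×ˢ ball (0 : (EuclideanSpace ℝ (Fin 3))) r =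
      Ioo (-(R ^ 2 + r ^ 2)) 0 ×ˢ ball (0 : (EuclideanSpace ℝ (Fin 3))) r := by
    rw [show -R ^ 2 - r ^ 2 = -(R ^ 2 + r ^ 2) by ring]
  rw [hwin]
  have hae : ∀ i j : Fin 3, ∀ᵐ q ∂μ₃, |spinEntry G i j q| ≤ Kenn.toReal := by
    intro i j
    have hle : eLpNorm (spinEntry G i j) ⊤ μ₃ ≤ Kenn :=
      (eLpNorm_spinEntry_le_sum G i j).trans hchain
    filter_upwards [ae_le_eLpNormEssSup (f := spinEntry G i j) (μ := μ₃)] with q hq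
    have h1 : ‖spinEntry G i j q‖ₑ ≤ Kenn := by
      refine hq.trans (le_trans (le_of_eq ?_) hle)
      rw [eLpNorm_exponent_top]
    rw [← Real.norm_eq_abs, ← toReal_enorm]
    exact (ENNReal.toReal_le_toReal enorm_ne_top hKtop).2 h1
  have hall : ∀ᵐ q ∂μ₃, ∀ i j : Fin 3, |spinEntry G i j q| ≤ Kenn.toReal :=
    ae_all_iff.2 fun i => ae_all_iff.2 fun j => hae i j
  filter_upwards [hall] with q hq i j
  have := hq i j
  rw [spinEntry_apply] at this
  exact this

/-- **Spatial Hölder continuity of the slices up to the top, with the constants fixed before the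
solution** (Serrin 1962; Robinson–Rodrigo–Sadowski 2016, Thm. 13.7 with `q = q' = ∞`, proof
§13.3.2 Steps 1–4, made quantitative). For `0 < r < R`, `M`, `B` there are `C`, `α > 0` such that,
for every `(u, p, G)` as in `spin_bound_top_quant` on `Q*_R((-R², 0)) = ]-2R², 0[ × B(0, R)`, for
a.e. `t ∈ ]-R² - r², 0[` the slice `u(t, ·)` agrees a.e. on `B(0, r)` with a `(C, α)`-Hölder
field. Proof: the accepted `SerrinTop.holder_slices_top`, fed with `spin_bound_top_quant` on the
`ρ`-cylinder, `ρ = (r + R)/2`, and `SerrinBoundedHolder.exists_holder_slice` with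
`LaplaceDivFormInteriorHolder_holds` (whose constants depend on the radii only).
[cite: RobinsonRodrigoSadowskiCUP2016, Thm. 13.7 (q = q' = ∞) with its proof §13.3.2, Steps 1–4, (13.18)–(13.19); SereginSverak2009 §2 p. 8] -/
theorem holder_slices_top_quant {R r : ℝ} (hr0 : 0 < r) (hrR : r < R) (M : ℝ) (B : ℝ≥0) :
    ∃ C α : ℝ≥0, 0 < α ∧ ∀ (u : ℝ → (EuclideanSpace ℝ (Fin 3)) → (EuclideanSpace ℝ (Fin 3))) (p : ℝ → (EuclideanSpace ℝ (Fin 3)) → ℝ) (G : ℝ → (EuclideanSpace ℝ (Fin 3)) → (EuclideanSpace ℝ (Fin 3)) →L[ℝ] (EuclideanSpace ℝ (Fin 3))),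
      IsDistributionalNSSolutionOn (parabolicCylinderCenteredOpens R ((-R ^ 2 : ℝ), (0 : (EuclideanSpace ℝ (Fin 3))))) 1 0 u p →
      (∀ᵐ w ∂(volume.restrict (parabolicCylinderCentered R ((-R ^ 2 : ℝ), (0 : (EuclideanSpace ℝ (Fin 3)))))),
        ‖u w.1 w.2‖ ≤ M) →
      HasWeakSpatialGradientOn (parabolicCylinderCenteredOpens R ((-R ^ 2 : ℝ), (0 : (EuclideanSpace ℝ (Fin 3))))) u G →
      (∫⁻ w in parabolicCylinderCentered R ((-R ^ 2 : ℝ), (0 : (EuclideanSpace ℝ (Fin 3)))),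
          ENNReal.ofReal (frobeniusNormSq (G w.1 w.2)) ≤ B) →
      ∀ᵐ t ∂(volume.restrict (Ioo (-R ^ 2 - r ^ 2) 0)),
        ∃ v : (EuclideanSpace ℝ (Fin 3)) → (EuclideanSpace ℝ (Fin 3)), HolderOnWith C α v (ball (0 : (EuclideanSpace ℝ (Fin 3))) r) ∧
          u t =ᵐ[volume.restrict (ball (0 : (EuclideanSpace ℝ (Fin 3))) r)] v := by
  have hR0 : 0 < R := hr0.trans hrR
  -- an intermediate radius `r < ρ < R`
  set ρ : ℝ := (r + R) / 2 with hρ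
  have hrρ : r < ρ := by rw [hρ]; linarith
  have hρR : ρ < R := by rw [hρ]; linarith
  have hρ0 : 0 < ρ := hr0.trans hrρ
  -- bounded spin up to the top on the `ρ`-cylinder, and the slice estimate: constants first
  obtain ⟨K, -, hK⟩ := spin_bound_top_quant hρ0 hρR M B
  obtain ⟨C₀, α, hα, hslice⟩ :=
    SerrinBoundedHolder.exists_holder_slice LaplaceDivFormInteriorHolder_holds hr0 hrρ
  refine ⟨C₀ * (volume (ball (0 : (EuclideanSpace ℝ (Fin 3))) ρ) ^ (2⁻¹ : ℝ) * ENNReal.ofReal |M| +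
    ENNReal.ofReal (3 * |K|)).toNNReal, α, hα, ?_⟩
  intro u p G hsol hbd hG hGB
  set z₀ : ℝ × (EuclideanSpace ℝ (Fin 3)) := ((-R ^ 2 : ℝ), (0 : (EuclideanSpace ℝ (Fin 3)))) with hz₀
  have hG2 : ∫⁻ w in parabolicCylinderCentered R z₀, ENNReal.ofReal (frobeniusNormSq (G w.1 w.2)) < ∞ :=
    lt_of_le_of_lt hGB ENNReal.coe_lt_top
  have hKae := hK u p G hsol hbd hG hGB
  -- the product cylinder `I × B(0, ρ)` sharing the top
  set I : Set ℝ := Ioo (-R ^ 2 - ρ ^ 2) 0 with hI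
  have hsub : I ×ˢ ball (0 : (EuclideanSpace ℝ (Fin 3))) ρ ⊆ parabolicCylinderCentered R z₀ := by
    refine prod_mono (Ioo_subset_Ioo ?_ ?_) (ball_subset_ball hρR.le)
    · show -R ^ 2 - R ^ 2 ≤ -R ^ 2 - ρ ^ 2
      nlinarith
    · show (0 : ℝ) ≤ -R ^ 2 + R ^ 2
      linarith
  have hle : (⟨I ×ˢ ((⟨ball (0 : (EuclideanSpace ℝ (Fin 3))) ρ, isOpen_ball⟩ : Opens (EuclideanSpace ℝ (Fin 3))) : Set (EuclideanSpace ℝ (Fin 3))),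
      isOpen_Ioo.prod (⟨ball (0 : (EuclideanSpace ℝ (Fin 3))) ρ, isOpen_ball⟩ : Opens (EuclideanSpace ℝ (Fin 3))).isOpen⟩ :
        Opens (ℝ × (EuclideanSpace ℝ (Fin 3)))) ≤ parabolicCylinderCenteredOpens R z₀ :=
    fun q hq => hsub hq
  have hGρ : HasWeakSpatialGradientOn
      (⟨I ×ˢ ((⟨ball (0 : (EuclideanSpace ℝ (Fin 3))) ρ, isOpen_ball⟩ : Opens (EuclideanSpace ℝ (Fin 3))) : Set (EuclideanSpace ℝ (Fin 3))),
        isOpen_Ioo.prod (⟨ball (0 : (EuclideanSpace ℝ (Fin 3))) ρ, isOpen_ball⟩ : Opens (EuclideanSpace ℝ (Fin 3))).isOpen⟩ :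
        Opens (ℝ × (EuclideanSpace ℝ (Fin 3)))) u G :=
    hG.mono hle
  -- (S1) slices have weak gradients on the ball
  have hS1 : ∀ᵐ t ∂(volume.restrict I), FunctionSpaces.HasWeakFDerivOn
      (⟨ball (0 : (EuclideanSpace ℝ (Fin 3))) ρ, isOpen_ball⟩ : Opens (EuclideanSpace ℝ (Fin 3))) volume (u t) (G t) :=
    hGρ.ae_hasWeakFDerivOn_slice
  -- (S2) the bound, (S3) the spin bound, (S5) the trace, slice-wise
  have hS2 : ∀ᵐ t ∂(volume.restrict I), ∀ᵐ x ∂(volume.restrict (ball (0 : (EuclideanSpace ℝ (Fin 3))) ρ)), ‖u t x‖ ≤ M :=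
    SerrinBoundedHolder.ae_ae_of_ae_restrict_prod (P := fun w => ‖u w.1 w.2‖ ≤ M)
      (ae_restrict_of_ae_restrict_of_subset hsub hbd)
  have hS3 : ∀ᵐ t ∂(volume.restrict I), ∀ᵐ x ∂(volume.restrict (ball (0 : (EuclideanSpace ℝ (Fin 3))) ρ)),
      ∀ i j : Fin 3, |G t x (EuclideanSpace.single (j : Fin 3) (1 : ℝ)) i - G t x (EuclideanSpace.single (i : Fin 3) (1 : ℝ)) j| ≤ K :=
    SerrinBoundedHolder.ae_ae_of_ae_restrict_prod
      (P := fun w => ∀ i j : Fin 3, |G w.1 w.2 (EuclideanSpace.single (j : Fin 3) (1 : ℝ)) i - G w.1 w.2 (EuclideanSpace.single (i : Fin 3) (1 : ℝ)) j| ≤ K) hKae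
  have hS5 : ∀ᵐ t ∂(volume.restrict I), ∀ᵐ x ∂(volume.restrict (ball (0 : (EuclideanSpace ℝ (Fin 3))) ρ)),
      ∑ j, G t x (EuclideanSpace.single (j : Fin 3) (1 : ℝ)) j = 0 := by
    have h := SerrinBoundedHolder.ae_trace_eq_zero hsol hG
    have h' : ∀ᵐ w ∂(volume.restrict (I ×ˢ ball (0 : (EuclideanSpace ℝ (Fin 3))) ρ)), ∑ j, G w.1 w.2 (EuclideanSpace.single (j : Fin 3) (1 : ℝ)) j = 0 := by
      rw [ae_restrict_iff' (measurableSet_Ioo.prod measurableSet_ball)]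
      filter_upwards [h] with w hw hwρ
      exact hw (hsub hwρ)
    exact SerrinBoundedHolder.ae_ae_of_ae_restrict_prod
      (P := fun w => ∑ j, G w.1 w.2 (EuclideanSpace.single (j : Fin 3) (1 : ℝ)) j = 0) h'
  -- (S4) the energy, slice-wise
  have hGm : AEStronglyMeasurable (uncurry G) (volume.restrict (I ×ˢ ball (0 : (EuclideanSpace ℝ (Fin 3))) ρ)) :=
    (hG.locallyIntegrableOn_grad.mono_set hsub).aestronglyMeasurable
  have hS4 : ∀ᵐ t ∂(volume.restrict I), ∫⁻ x in ball (0 : (EuclideanSpace ℝ (Fin 3))) ρ, ‖G t x‖ₑ ^ (2 : ℝ) < ∞ := by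
    refine SerrinBoundedHolder.ae_lintegral_lt_top_of_lintegral_prod
      (f := fun w => ‖G w.1 w.2‖ₑ ^ (2 : ℝ)) ?_ ?_
    · exact (hGm.aemeasurable.enorm.pow_const _)
    · calc ∫⁻ w in I ×ˢ ball (0 : (EuclideanSpace ℝ (Fin 3))) ρ, ‖G w.1 w.2‖ₑ ^ (2 : ℝ)
          ≤ ∫⁻ w in I ×ˢ ball (0 : (EuclideanSpace ℝ (Fin 3))) ρ, ENNReal.ofReal (frobeniusNormSq (G w.1 w.2)) :=
            lintegral_mono fun w => SerrinBoundedHolder.enorm_rpow_two_le_ofReal_frobeniusNormSq _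
        _ ≤ ∫⁻ w in parabolicCylinderCentered R z₀, ENNReal.ofReal (frobeniusNormSq (G w.1 w.2)) :=
            lintegral_mono_set hsub
        _ < ⊤ := hG2
  -- the conclusion on the smaller time window (same top)
  have hIr : Ioo (-R ^ 2 - r ^ 2) 0 ⊆ I := by
    have : r ^ 2 < ρ ^ 2 := by nlinarith
    exact Ioo_subset_Ioo (by linarith) le_rfl
  refine ae_restrict_of_ae_restrict_of_subset hIr ?_
  filter_upwards [hS1, hS2, hS3, hS4, hS5] with t h1 h2 h3 h4 h5
  have hgm : AEStronglyMeasurable (G t) (volume.restrict (ball (0 : (EuclideanSpace ℝ (Fin 3))) ρ)) :=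
    h1.locallyIntegrableOn_deriv.aestronglyMeasurable
  have hg2 : MemLp (G t) 2 (volume.restrict (ball (0 : (EuclideanSpace ℝ (Fin 3))) ρ)) := by
    refine ⟨hgm, ?_⟩
    rw [eLpNorm_eq_lintegral_rpow_enorm_toReal two_ne_zero ENNReal.ofNat_ne_top,
      ENNReal.toReal_ofNat]
    refine ENNReal.rpow_lt_top_of_nonneg (by norm_num) ?_
    exact h4.ne
  obtain ⟨v', hv'H, hv'ae⟩ := hslice 0 M K (u t) (G t) h1 h2 hg2 h3 h5
  exact ⟨v', hv'H, hv'ae⟩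

end SerrinTopQuant

end Literature.Analysis.FluidPDE

end
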